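import Mathlib
import Literature.MathematicalPhysics.KineticTheory.HardSphereEuler
import Literature.Analysis.FluidPDE.HardSphereCollisionRecord
import HarnessLib

/-!
# Vocabulary of the line `Sketch` (card `two-time-pinch`, composed/reshaped by the lead) for the crux
`KickFairRelEquilibriumMeso` (stmt-AtomisticToContinuum-15177; rank 2 of route `InformationPercolationEngine`)

Definitions-only support file (`--supports stmt-AtomisticToContinuum-15177`) of the lead prover of the line
(`Cruxes/KickFairRelEquilibriumMeso/Lines/Sketch.lean`; skeleton registered on the item with the seven stubs
`stub_binOscillation`, `stub_keyCount`, `stub_energyTail`, `stub_countTail`, `stub_pastMeasurable`,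
`stub_restartFairness`, `stub_pinchTransfer`). It makes the line's vocabulary IMPORTABLE so that each
registered stub can land in its own sorry-free Theorems file with the registered signature verbatim. Every
object is a byte-for-byte copy of a `let` of the crux
`Summit.AtomisticToContinuum.HydrodynamicLimit.Theses.InformationPercolationEngine.KickFairRelEquilibriumMeso`
(the typed past `past`, the kick datum `kick`, the centring `kappa`, the count `cnt`), or an elementary
function of them (the windowed kick sum `slotSum` = the crux's `S` with one extra indicator on the collision
time; the normalised collision count `countFn`), or a static bookkeeping device of the line (the cell
sequence `rs N = (N+1)^{-1/4}`, the kinetic time `tN N = (N+1)^{-1/3}`, twice the kinetic energy `kinEnergy`,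
the binned time-zero cell data `cellKey`). The six statements the stubs prove or consume are the `Prop`s
`BinOscillation`, `KeyCount`, `EnergyTail`, `CountTail`, `PastMeasurable`, `RestartFairness`; nothing is
asserted here (every `def … : Prop` is a predicate a stub proves or the glue consumes, never a hypothesis
taken as a fact).

The mathematics (card `Ideas/two-time-pinch.md`, lead's `PICKED.md`): the local Gibbs law `LG` is compared
with the invariant law `G` LEVEL SET BY LEVEL SET of the time-zero key, by density domination
(`LG_B ≤ Λ_B G_B`, `log Λ_B = osc_B log(dLG/dG) = o(N)`: `BinOscillation`), so that a sub-exponential loss is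
beaten by any speed-`N` concentration of the windowed kick sum under the pinched invariant law
(`RestartFairness` (ii)) once its conditional mean is small (`RestartFairness` (i), the Boltzmann-class
content); atypical and hot level sets are paid by `KeyCount`, `CountTail`, `EnergyTail` and the landed global
domination `exists_localGibbsMeasure_le_smul_const`; `PastMeasurable` is the Borel plumbing of the typed past.
-/

noncomputable section

open MeasureTheory Set Filter Topology
open scoped ENNReal Classical

namespace Summit.AtomisticToContinuum.HydrodynamicLimit.Theorems.KickFairRelEquilibriumMesoLine

open Literature.Analysis.FluidPDE Literature.MathematicalPhysics.KineticTheory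

/-! ## Vocabulary -/

/-- The line's cell sequence `rs N = (N+1)^{-1/4}` (admissible for the crux: positive, `→ 0`,
`(N+1) rs³ = (N+1)^{1/4} → ∞`); also used as the bin width of cell momenta and energies. -/
def rs (N : ℕ) : ℝ := ((N : ℝ) + 1) ^ (-(1 / 4 : ℝ))

/-- The kinetic time scale `t_N = (N+1)^{-1/3}` (`≍` one mean free time at fixed `σ`): the window length. -/
def tN (N : ℕ) : ℝ := ((N : ℝ) + 1) ^ (-(1 / 3 : ℝ))

/-- The type of the crux's typed past `p_{i,n}`: two coarse photos (cells + exact velocities of all spheres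
at the two flight starts), the partner label, and the times `(s_i, s_q, t_{i,n})`. -/
abbrev Past (N : ℕ) : Type :=
  (((Fin (N + 1) → (Fin 3 → ℤ) × V3) × (Fin (N + 1) → (Fin 3 → ℤ) × V3)) × Fin (N + 1)) × (ℝ × ℝ × ℝ)

/-- Phase space of `N + 1` spheres on `𝕋³`. -/
abbrev Phase (N : ℕ) : Type := Config (N + 1) (Fin 3) T3

/-- Hard-sphere flows of `N + 1` spheres of reduced diameter `σ` (diameter `hsDiameter σ N`). -/
abbrev Flow (σ : ℝ) (N : ℕ) : Type :=
  HardSphereFlow (Torus.geometry (Fin 3)) (hsDiameter σ N) (N + 1)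

/-- Twice the kinetic energy, `Σ_i ‖v_i‖²`. -/
def kinEnergy {N : ℕ} (z : Phase N) : ℝ := ∑ i, ‖(z i).2‖ ^ 2

/-- The **binned time-zero cell data** (the key of the pinch): for each `r`-cell `k` of `𝕋³`
(`Torus.coarseCell r`), the number of particles in it, the integer parts of (total momentum)/`w`
coordinatewise and of (twice the kinetic energy)/`w`. Empty cells (in particular every `k` outside the
finite range of `Torus.coarseCell r`) get `(0, 0, 0)`. -/
def cellKey {N : ℕ} (r w : ℝ) (z : Phase N) (k : Fin 3 → ℤ) : ℕ × (Fin 3 → ℤ) × ℤ :=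
  let I : Finset (Fin (N + 1)) := Finset.univ.filter fun i => Torus.coarseCell r (z i).1 = k
  (I.card, fun j => ⌊(∑ i ∈ I, (z i).2) j / w⌋, ⌊(∑ i ∈ I, ‖(z i).2‖ ^ 2) / w⌋)

/-- The number of collision times of sphere `i` in `(0, τ]` along the orbit of `z` (the crux's `cnt`,
verbatim: not cut to the good set). -/
def cnt {σ : ℝ} {N : ℕ} (Φ : Flow σ N) (τ : ℝ) (z : Phase N) (i : Fin (N + 1)) : ℕ :=
  Set.ncard (collisionTimesOf (Torus.geometry (Fin 3)) (hsDiameter σ N) (fun s => Φ.flow s z) i ∩ Set.Ioc 0 τ)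

/-- The crux's typed past `P z i n` at mesh `r` (verbatim: cut to the good set, junk off it). -/
def past {σ : ℝ} {N : ℕ} (Φ : Flow σ N) (r : ℝ) (z : Phase N) (i : Fin (N + 1)) (n : ℕ) : Past N :=
  if z ∈ Φ.good then
    ((Φ.coarsePastOf (Torus.coarseCell r) i n z, Φ.nthPartnerOf i n z),
      (flightStart (Torus.geometry (Fin 3)) (hsDiameter σ N) (fun s => Φ.flow s z) 0 i (Φ.nthCollisionTimeOf i n z),
        flightStart (Torus.geometry (Fin 3)) (hsDiameter σ N) (fun s => Φ.flow s z) 0 (Φ.nthPartnerOf i n z)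
          (Φ.nthCollisionTimeOf i n z),
        Φ.nthCollisionTimeOf i n z))
  else (((fun _ => (0, 0), fun _ => (0, 0)), 0), (0, 0, 0))

/-- The crux's kick datum `X i n z = (ω, v⁻, v*⁻)` of the `n`-th collision of `i` (verbatim: cut to the good set). -/
def kick {σ : ℝ} {N : ℕ} (Φ : Flow σ N) (i : Fin (N + 1)) (n : ℕ) (z : Phase N) : V3 × V3 × V3 :=
  if z ∈ Φ.good then ((Φ.nthRecordOf i n z).impactVec, (Φ.nthRecordOf i n z).preVel) else 0

/-- The crux's centring `κ i n = E_G[g(X i n) | σ(P · i n)]` (Mathlib `condExp` given the comap σ-algebra of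
the typed past) under the INVARIANT law `G = localGibbsLaw σ 1 0 1 N Φ` (verbatim). -/
def kappa {σ : ℝ} {N : ℕ} (Φ : Flow σ N) (r : ℝ) (g : V3 × V3 × V3 → ℝ) (i : Fin (N + 1)) (n : ℕ) :
    Phase N → ℝ :=
  MeasureTheory.condExp (MeasurableSpace.comap (fun z => past Φ r z i n) inferInstance)
    (localGibbsLaw σ (fun _ => 1) (fun _ => 0) (fun _ => 1) N Φ) (fun z => g (kick Φ i n z))

/-- The **windowed kick sum** `Z_{(t₁,t₂]}`: the crux's compensated kick sum restricted to kicks with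
`t_{i,n} ∈ (t₁, t₂]` (same `ε, cnt, P, X, κ`; one extra indicator). Summing the windows of a partition of
`(0, τ]` returns the crux's `S` (for `n < cnt` the enumeration is genuine and `≤ τ`). -/
def slotSum {σ : ℝ} {N : ℕ} (Φ : Flow σ N) (τ r t₁ t₂ : ℝ) (g : V3 × V3 × V3 → ℝ)
    (h : Fin (N + 1) → ℕ → Past N → ℝ) (z : Phase N) : ℝ :=
  hsDiameter σ N / ((N : ℝ) + 1) * ∑ i : Fin (N + 1), ∑ n ∈ Finset.range (cnt Φ τ z i),
    (if t₁ < Φ.nthCollisionTimeOf i n z ∧ Φ.nthCollisionTimeOf i n z ≤ t₂ then (1 : ℝ) else 0) *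
      (h i n (past Φ r z i n) * (g (kick Φ i n z) - kappa Φ r g i n z))

/-- The **normalised collision count** `W(z) = (ε/(N+1)) Σ_i cnt_i(z)`, cut to the good set (it dominates
`|Z_{(t₁,t₂]}| / (2‖g‖_∞)` for every window, `G`-a.e.). -/
def countFn {σ : ℝ} {N : ℕ} (Φ : Flow σ N) (τ : ℝ) (z : Phase N) : ℝ :=
  hsDiameter σ N / ((N : ℝ) + 1) * ∑ i : Fin (N + 1), (if z ∈ Φ.good then (cnt Φ τ z i : ℝ) else 0)

/-! ## The six statements of the line (predicates; proved by the stubs, consumed by the glue) -/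

/-- **S0′ — oscillation of `log (dLG/dG)` over a level set of the time-zero key.** For continuous positive
profiles and every `η > 0`, eventually in `N`, for every reduced diameter and all configurations `z, z'` with
the same key at mesh and width `rs N`: `f(z) f₁(z') ≤ exp(η((N+1) + KE(z) + KE(z'))) f(z') f₁(z)`, where `f, f₁`
are the canonical densities of the local Gibbs law and of the invariant law (`dLG/dG ∝ f/f₁` on the hard-sphere
domain; partition functions and the hard-core indicator cancel in this four-term form, both sides vanish off the
domain). Content: the one-body log-tilt grouped by cells; cell centres cost a modulus of continuity of the
profiles times `1 + ‖v‖²` per particle; the cell-centred Maxwellian tilt is affine in the binned cell momentum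
and energy. -/
def BinOscillation : Prop :=
  ∀ (a₀ θ₀ : T3 → ℝ) (u₀ : T3 → V3), Continuous a₀ → Continuous θ₀ → Continuous u₀ →
    (∀ x, 0 < a₀ x) → (∀ x, 0 < θ₀ x) →
    ∀ η : ℝ, 0 < η → ∃ N₀ : ℕ, ∀ N : ℕ, N₀ ≤ N → ∀ σ : ℝ, ∀ z z' : Phase N,
    cellKey (rs N) (rs N) z = cellKey (rs N) (rs N) z' →
    canonicalDensity (Torus.geometry (Fin 3)) (hsDiameter σ N) (N + 1) (localGibbsProfile a₀ u₀ θ₀) z *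
        canonicalDensity (Torus.geometry (Fin 3)) (hsDiameter σ N) (N + 1)
          (localGibbsProfile (fun _ => 1) (fun _ => 0) (fun _ => 1)) z' ≤
      Real.exp (η * (((N : ℝ) + 1) + kinEnergy z + kinEnergy z')) *
        (canonicalDensity (Torus.geometry (Fin 3)) (hsDiameter σ N) (N + 1) (localGibbsProfile a₀ u₀ θ₀) z' *
          canonicalDensity (Torus.geometry (Fin 3)) (hsDiameter σ N) (N + 1)
            (localGibbsProfile (fun _ => 1) (fun _ => 0) (fun _ => 1)) z)

/-- **KC — there are only `exp(O((N+1)^{3/4} log(N+2)))` keys of bounded energy.** For every cap `K ≥ 0` there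
is `C` such that for every `N` the keys of configurations with `KE ≤ K(N+1)` lie in a finite set of cardinality
`≤ exp(C (N+1)^{3/4} log(N+2))` (cells in range `≤ (1/rs N + 3)³`, counts `≤ N+1`, cell momenta `≤ (N+1)√K`
coordinatewise, cell energies `≤ K(N+1)`, both binned at width `rs N`). -/
def KeyCount : Prop :=
  ∀ K : ℝ, 0 ≤ K → ∃ C : ℝ, ∀ N : ℕ, ∃ s : Finset ((Fin 3 → ℤ) → ℕ × (Fin 3 → ℤ) × ℤ),
    (s.card : ℝ) ≤ Real.exp (C * ((N : ℝ) + 1) ^ (3 / 4 : ℝ) * Real.log ((N : ℝ) + 2)) ∧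
    ∀ z : Phase N, kinEnergy z ≤ K * ((N : ℝ) + 1) → cellKey (rs N) (rs N) z ∈ s

/-- **E2 — large-deviation upper tail of the kinetic energy under the invariant laws** `G_θ = localGibbsLaw σ 1 0 θ`
(`σ < 1/2`): velocities are i.i.d. centred Maxwellians of temperature `θ`, so for every rate `M` there is a cap
`K` with `G_θ(KE > K(N+1)) ≤ e^{-M(N+1)}` (Chernoff for `χ²_{3(N+1)}`). -/
def EnergyTail : Prop :=
  ∀ θ : ℝ, 0 < θ → ∀ M : ℝ, 0 ≤ M → ∃ K : ℝ, ∃ N₀ : ℕ, ∀ N : ℕ, N₀ ≤ N →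
    ∀ σ : ℝ, 0 < σ → σ < 1 / 2 → ∀ Φ : Flow σ N,
    localGibbsLaw σ (fun _ => 1) (fun _ => 0) (fun _ => θ) N Φ {z | K * ((N : ℝ) + 1) < kinEnergy z} ≤
      ENNReal.ofReal (Real.exp (-(M * ((N : ℝ) + 1))))

/-- **E1 — equilibrium tail of the normalised collision count, `L²` form** (Campbell / Lanford-at-fixed-density
class): under `G_θ`, for every horizon `τ` and rate `M` there is a threshold `λ` beyond which the restricted second
moment of `W = (ε/(N+1)) Σ_i cnt_i` is `≤ e^{-M(N+1)}`, eventually in `N`. -/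
def CountTail : Prop :=
  ∀ θ : ℝ, 0 < θ → ∀ σ : ℝ, 0 < σ → σ < 1 / 2 → ∀ Φ : (N : ℕ) → Flow σ N, ∀ τ : ℝ, 0 < τ →
    ∀ M : ℝ, 0 ≤ M → ∃ lam : ℝ, ∃ N₀ : ℕ, ∀ N : ℕ, N₀ ≤ N →
    ∫⁻ z in {z | lam < countFn (Φ N) τ z}, ENNReal.ofReal (1 + countFn (Φ N) τ z ^ 2)
        ∂(localGibbsLaw σ (fun _ => 1) (fun _ => 0) (fun _ => θ) N (Φ N)) ≤
      ENNReal.ofReal (Real.exp (-(M * ((N : ℝ) + 1))))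

/-- **M — Borel plumbing of the typed past**: for every flow, mesh, horizon, sphere and index, the typed past
(cut to the good set), the kick datum and the windowed count (cut to the good set) are measurable functions of
the initial datum (so the comap σ-algebra of the past is a sub-σ-algebra of the Borel one and `κ` is a genuine
conditional expectation). -/
def PastMeasurable : Prop :=
  ∀ σ : ℝ, 0 < σ → ∀ N : ℕ, ∀ Φ : Flow σ N, ∀ r τ : ℝ, ∀ i : Fin (N + 1), ∀ n : ℕ,
    Measurable (fun z => past Φ r z i n) ∧ Measurable (kick Φ i n) ∧
      Measurable (fun z => if z ∈ Φ.good then cnt Φ τ z i else 0)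

/-- **R″ — restart fairness under a typical backward conditioning** (the card's R1 ∧ R2, reshaped;
Boltzmann-hypothesis class). For continuous positive profiles, `σ < 1/2`, every flow family, horizon, bounded
continuous `g`, bias target `δ` and relative deviation `1/L`, there are `c, η > 0` such that eventually in `N`,
uniformly over measurable weights `|h| ≤ 1`, kinetic windows `(t₁, t₂] ⊆ [0, τ]` of length `≤ t_N` and level sets
`B` of the time-zero key carrying `LG`-mass `≥ e^{-η(N+1)}`: (o) the windowed kick sum `Z` is `G`-integrable;
(i) BIAS `|E_G[Z; B]| ≤ δ t_N G(B)`; (ii) CONCENTRATION `G(B ∩ {|Z − m_B| > t_N/L}) ≤ e^{-c(N+1)} G(B)`, `m_B` the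
conditional mean. -/
def RestartFairness : Prop :=
  ∀ (a₀ θ₀ : T3 → ℝ) (u₀ : T3 → V3), Continuous a₀ → Continuous θ₀ → Continuous u₀ →
    (∀ x, 0 < a₀ x) → (∀ x, 0 < θ₀ x) →
    ∀ σ : ℝ, 0 < σ → σ < 1 / 2 → ∀ Φ : (N : ℕ) → Flow σ N, ∀ τ : ℝ, 0 < τ →
    ∀ g : V3 × V3 × V3 → ℝ, Continuous g → (∃ C : ℝ, ∀ p, |g p| ≤ C) →
    ∀ δ : ℝ, 0 < δ → ∀ L : ℝ, 0 < L →
    ∃ c : ℝ, 0 < c ∧ ∃ η : ℝ, 0 < η ∧ ∃ N₀ : ℕ, ∀ N : ℕ, N₀ ≤ N →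
    ∀ h : Fin (N + 1) → ℕ → Past N → ℝ, (∀ i n, Measurable (h i n)) → (∀ i n p, |h i n p| ≤ 1) →
    ∀ t₁ t₂ : ℝ, 0 ≤ t₁ → t₁ ≤ t₂ → t₂ ≤ τ → t₂ ≤ t₁ + tN N →
    ∀ z₀ : Phase N,
    let LG := localGibbsLaw σ a₀ u₀ θ₀ N (Φ N)
    let G := localGibbsLaw σ (fun _ => 1) (fun _ => 0) (fun _ => 1) N (Φ N)
    let B : Set (Phase N) := {z | cellKey (rs N) (rs N) z = cellKey (rs N) (rs N) z₀}
    let Z : Phase N → ℝ := slotSum (Φ N) τ (rs N) t₁ t₂ g h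
    let m : ℝ := (G B).toReal⁻¹ * ∫ z in B, Z z ∂G
    ENNReal.ofReal (Real.exp (-(η * ((N : ℝ) + 1)))) ≤ LG B →
      Integrable Z G ∧
      |∫ z in B, Z z ∂G| ≤ δ * tN N * (G B).toReal ∧
      G (B ∩ {z | tN N / L < |Z z - m|}) ≤ ENNReal.ofReal (Real.exp (-(c * ((N : ℝ) + 1)))) * G B

/-! ## Sanity lemmas (the cell sequence is admissible for the crux) -/

/-- `rs N > 0`. -/
theorem rs_pos (N : ℕ) : 0 < rs N := by
  unfold rs; positivity

/-- `tN N > 0`. -/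
theorem tN_pos (N : ℕ) : 0 < tN N := by
  unfold tN; positivity

/-- `(N+1) · (rs N)³ = (N+1)^{1/4}` (the number of particles per cell, up to the cell volume factor). -/
theorem succ_mul_rs_pow_three (N : ℕ) : ((N : ℝ) + 1) * rs N ^ 3 = ((N : ℝ) + 1) ^ (1 / 4 : ℝ) := by
  have hN : (0 : ℝ) < (N : ℝ) + 1 := by positivity
  unfold rs
  rw [← Real.rpow_natCast, ← Real.rpow_mul hN.le]
  conv_lhs => rw [show ((N : ℝ) + 1) = ((N : ℝ) + 1) ^ (1 : ℝ) by simp]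
  rw [← Real.rpow_mul hN.le, ← Real.rpow_add hN]
  norm_num

/-- `rs N → 0`. -/
theorem tendsto_rs : Tendsto rs atTop (𝓝 0) := by
  have h1 : Tendsto (fun N : ℕ => ((N : ℝ) + 1)) atTop atTop :=
    tendsto_atTop_add_const_right _ 1 tendsto_natCast_atTop_atTop
  have h2 := (tendsto_rpow_neg_atTop (show (0 : ℝ) < 1 / 4 by norm_num)).comp h1
  refine h2.congr fun N => ?_
  simp [rs, Function.comp]

/-- `(N+1) (rs N)³ → ∞`. -/
theorem tendsto_succ_mul_rs_pow_three :
    Tendsto (fun N : ℕ => ((N : ℝ) + 1) * rs N ^ 3) atTop atTop := by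
  have h1 : Tendsto (fun N : ℕ => ((N : ℝ) + 1)) atTop atTop :=
    tendsto_atTop_add_const_right _ 1 tendsto_natCast_atTop_atTop
  have h2 := (tendsto_rpow_atTop (show (0 : ℝ) < 1 / 4 by norm_num)).comp h1
  refine h2.congr fun N => ?_
  simp [Function.comp, succ_mul_rs_pow_three]

/-- **The line's cell sequence is admissible for the crux** (registered sub-goal `rs_admissible` of the
skeleton: the `∃ rs` prefix of `KickFairRelEquilibriumMeso` is witnessed by `rs N = (N+1)^{-1/4}`). -/
theorem rs_admissible :
    (∀ N : ℕ, 0 < rs N) ∧ Tendsto rs atTop (𝓝 0) ∧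
      Tendsto (fun N : ℕ => ((N : ℝ) + 1) * rs N ^ 3) atTop atTop :=
  ⟨rs_pos, tendsto_rs, tendsto_succ_mul_rs_pow_three⟩

end Summit.AtomisticToContinuum.HydrodynamicLimit.Theorems.KickFairRelEquilibriumMesoLine

end
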